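import Mathlib
import Summits.ValiantsHypothesis.ValiantsHypothesis.Theorems.FifoMatchingNNMonotoneHard
import HarnessLib

/-!
# Route `FifoMatching`, support item `NNMonotoneExpBound` (stmt-ValiantsHypothesis-22994):
# a stretched-exponential monotone lower bound for `NN_n`, uniformly in `n` — PROOF

`NNMonotoneExpBound`: there are `ε > 0` and `n₀` with `2^{n^ε} ≤ L₊(NN_n)` for all `n ≥ n₀`, where
`NN_n` is the nest-free (FIFO) matching polynomial over the semiring `ℝ≥0` and `L₊` the monotone
(fan-in-two) circuit complexity `Literature.Computability.AlgebraicComplexity.complexity`.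

This is the uniform-in-`n` bookkeeping of the landed proof of the crux `NNMonotoneHard`
(stmt-ValiantsHypothesis-11617, `nnMonotoneHard_proof`): the thick-queue measure
`exists_thick_measure` exists for EVERY length `2n = 2L + N` once `N` is large against the fixed
parameters `m, L, K` (its side conditions are inequalities), so no padding of the polynomial is
needed — only of the middle word.  We take all parameters polynomial in one integer `u`
(`r = 4u` tests, `m = u³`, `L = 8mu + 3m`, `K = 2L + 4m + 2`, threshold
`T(u) = 12Ku + 3L + 2K = 192u⁵ + 176u⁴ + 29u³ + 24u + 4`), and for a given `n` choose the largest
`u` with `T(u) ≤ n` (`Nat.findGreatest`), so that `T(u) ≤ n < T(u+1) ≤ 13600 u⁵`; then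
`N := 2n - 2L`, `J := (N-1)/K` satisfy the side conditions, the band estimate holds because
`m² / (2N) ≥ u / 54400`, every balanced split has mass `≤ 2N (3/4)^{4u}`, and the union bound
`exists_balanced_split_of_complexity` gives `L₊(NN_n) ≥ (256/81)^u / (8N(n+1)²) ≥ 2^u ≥ 2^{n^{1/6}}`
for `u ≥ 13600` (so `n < 13600 u⁵ ≤ u⁶`).  Hence `ε = 1/6` works (any `ε < 1/5` would, with more
care in the constants; not recorded).

Honest framing: a quantitative monotone lower bound for ONE candidate family — the `h = 1`
instance of the division rung `NNDivisionHard`; VP ≠ VNP is not moved by this file (monotone ≠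
general, `Literature.Barriers.ValiantsHypothesis.MonotoneGap`).  No definitions, no named facts.
-/

noncomputable section

-- Sub = Summit single-conjunct layout: the duplicated namespace component is mandated by the tree.
set_option linter.dupNamespace false

namespace Summit.ValiantsHypothesis.ValiantsHypothesis.Theorems.FifoMatching.NNMonotoneExpBound

open Finset Filter Literature.Computability.AlgebraicComplexity
open Summit.ValiantsHypothesis.ValiantsHypothesis.Theorems.FifoMatching.NNMonotoneHard
open scoped NNReal Topology

/-- **Lower bound from a spread measure.** If a probability weighting of the nest-free perfect
matchings of `[2n]` (`n ≥ 3`) respects every balanced split with mass `≤ β`, then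
`1 ≤ 4 · L₊(NN_n) · (n+1)² · β` (the union bound `exists_balanced_split_of_complexity`, recast in
`ℝ`). [folklore] -/
theorem one_le_complexity_mul_of_spread {n : ℕ} (hn : 3 ≤ n) {β : ℝ≥0}
    (μ : (Fin (2 * n) → Fin (2 * n)) → ℝ≥0) (hμ : ∑ M ∈ nestFreeMatchings (2 * n), μ M = 1)
    (hβ : ∀ S : Finset (Fin (2 * n)), 2 * n < 3 * S.card → 3 * S.card ≤ 4 * n →
      (∑ M ∈ (nestFreeMatchings (2 * n)).filter (fun M => ∀ i, i ∈ S ↔ M i ∈ S), μ M) ≤ β) :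
    (1 : ℝ) ≤ 4 * (complexity (nestFreeMatchingPoly n ℝ≥0) : ℝ) * ((n : ℝ) + 1) ^ 2 * (β : ℝ) := by
  obtain ⟨S, h1, h2, hbig⟩ := exists_balanced_split_of_complexity hn μ hμ
  have h := hbig.trans (mul_le_mul_of_nonneg_left (hβ S h1 h2) zero_le)
  have h' := NNReal.coe_le_coe.2 h
  push_cast at h'
  linarith [h']

/-- **The thick-queue measure at every large length.** For `u ≥ 1`, `m = u³`, `L = 8mu + 3m`,
`K = 2L + 4m + 2` and every `n ≥ 12Ku + 3L + 2K`, with `N = 2n - 2L` satisfying the band estimate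
`2N e^{-m²/(2N)} 2^N ≤ 2^N / (2N)`, there is a probability weighting of the nest-free perfect
matchings of `[2n]` under which every balanced split `S` (`2n < 3|S| ≤ 4n`) is respected with
mass `≤ 2N (3/4)^{4u}`: the side conditions of `exists_thick_measure` hold with `r = 4u` and
`J = ⌊(N-1)/K⌋`. [folklore] -/
theorem exists_thick_measure_of_le {u n m L K N : ℕ} (hu : 1 ≤ u) (hm : m = u ^ 3)
    (hL : L = 8 * m * u + 3 * m) (hK : K = 2 * L + 4 * m + 2) (hN : N = 2 * n - 2 * L)
    (hT : 12 * K * u + 3 * L + 2 * K ≤ n)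
    (hband : 2 * (N : ℝ) * Real.exp (-((m : ℝ) ^ 2 / (2 * N))) * 2 ^ N ≤ 2 ^ N / (2 * N)) :
    ∃ μ : (Fin (2 * n) → Fin (2 * n)) → ℝ≥0,
      (∑ Mt ∈ nestFreeMatchings (2 * n), μ Mt = 1) ∧
      ∀ S : Finset (Fin (2 * n)), 2 * n < 3 * S.card → 3 * S.card ≤ 4 * n →
        (∑ Mt ∈ (nestFreeMatchings (2 * n)).filter (fun Mt => ∀ i, i ∈ S ↔ Mt i ∈ S), μ Mt)
          ≤ (2 * N : ℝ≥0) * ((3 : ℝ≥0) / 4) ^ (4 * u) := by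
  set J : ℕ := (N - 1) / K with hJ
  have hKpos : 0 < K := by rw [hK]; omega
  have hm1 : 1 ≤ m := by rw [hm]; exact Nat.one_le_pow _ _ hu
  -- linearise the products for `omega`
  have eT : 12 * K * u = 12 * (K * u) := by ring
  have eL : 8 * m * u = 8 * (m * u) := by ring
  have er : 2 * K * (4 * u) = 8 * (K * u) := by ring
  have e16 : 4 * (4 * u) * K = 16 * (K * u) := by ring
  have emr : 2 * m * (4 * u) + 3 * m = 8 * (m * u) + 3 * m := by ring
  rw [eT] at hT
  have hLn : L ≤ n := by omega
  have hM : L + N + L = 2 * n := by rw [hN]; omega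
  have hmL : m ≤ L := by rw [hL, eL]; omega
  have hKe : 2 * L + 4 * m + 2 ≤ K := by rw [hK]
  have hNpos : 0 < N := by rw [hN]; omega
  -- `J K ≤ N - 1 < J K + K`
  have hdiv : K * J + (N - 1) % K = N - 1 := by rw [hJ]; exact Nat.div_add_mod (N - 1) K
  have hmod : (N - 1) % K < K := Nat.mod_lt _ hKpos
  have eKJ : K * J = J * K := Nat.mul_comm _ _
  have hJK : J * K + 1 ≤ N := by omega
  have hJK' : N ≤ J * K + K := by omega
  have hr1 : 4 * (4 * u) ≤ J := by
    rw [hJ, Nat.le_div_iff_mul_le hKpos, e16]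
    omega
  have hr3 : 2 * m * (4 * u) + 3 * m ≤ L := by rw [emr, hL, eL]
  have hreg : 3 * (2 * K * (4 * u) + (2 * n - J * K)) ≤ 2 * n := by
    rw [er]
    omega
  exact exists_thick_measure hM hmL hm1 hKe hJK hr1 hr3 hreg hNpos hband

/-- **`NN_n` has monotone complexity at least `2^{n^{1/6}}` for all large `n`** (the
quantitative, uniform-in-`n` form of `nnMonotoneHard_proof`; see the module docstring for the
parameter bookkeeping). [folklore] -/
theorem exp_lower_bound : ∃ n₀ : ℕ, ∀ n : ℕ, n₀ ≤ n →
    (2 : ℝ) ^ ((n : ℝ) ^ ((1 : ℝ) / 6)) ≤ (complexity (nestFreeMatchingPoly n ℝ≥0) : ℝ) := by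
  -- the two asymptotic requirements and `u ≥ 13600`, eventually in `u`
  have hexp0 : 0 ≤ Real.exp (-(1 / 54400 : ℝ)) := (Real.exp_pos _).le
  have hexp1 : Real.exp (-(1 / 54400 : ℝ)) < 1 := Real.exp_lt_one_iff.2 (by norm_num)
  have E1 := eventually_const_mul_pow_mul_pow_lt 10 (C := 4 * 27200 ^ 2) hexp0 hexp1 one_pos
  have E2 := eventually_const_mul_pow_mul_pow_lt 15 (C := 4 * 13601 ^ 2 * 54400)
    (a := 81 / 128) (by norm_num) (by norm_num) one_pos
  obtain ⟨u₀, hu₀⟩ := Filter.eventually_atTop.1 ((eventually_ge_atTop 13600).and (E1.and E2))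
  -- threshold `T(u) = 192u⁵ + 176u⁴ + 29u³ + 24u + 4`; `n₀ := T(u₀)`
  refine ⟨192 * u₀ ^ 5 + 176 * u₀ ^ 4 + 29 * u₀ ^ 3 + 24 * u₀ + 4, fun n hn => ?_⟩
  -- choose `u`: the largest with `T(u) ≤ n`
  set u : ℕ := Nat.findGreatest
    (fun u => 192 * u ^ 5 + 176 * u ^ 4 + 29 * u ^ 3 + 24 * u + 4 ≤ n) n with hu_def
  have hu₀n : u₀ ≤ n := le_trans (by omega) hn
  have hu₀u : u₀ ≤ u :=
    Nat.le_findGreatest (P := fun u => 192 * u ^ 5 + 176 * u ^ 4 + 29 * u ^ 3 + 24 * u + 4 ≤ n)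
      hu₀n hn
  have hTu : 192 * u ^ 5 + 176 * u ^ 4 + 29 * u ^ 3 + 24 * u + 4 ≤ n :=
    Nat.findGreatest_spec (P := fun u => 192 * u ^ 5 + 176 * u ^ 4 + 29 * u ^ 3 + 24 * u + 4 ≤ n)
      hu₀n hn
  have hule : u ≤ n :=
    Nat.findGreatest_le (P := fun u => 192 * u ^ 5 + 176 * u ^ 4 + 29 * u ^ 3 + 24 * u + 4 ≤ n) n
  have hun : u < n := by
    rcases hule.eq_or_lt with h | h
    · exfalso
      have hTu' := hTu
      rw [h] at hTu'
      omega
    · exact h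
  have hTu1 : ¬ (192 * (u + 1) ^ 5 + 176 * (u + 1) ^ 4 + 29 * (u + 1) ^ 3 + 24 * (u + 1) + 4 ≤ n) :=
    Nat.findGreatest_is_greatest
      (P := fun u => 192 * u ^ 5 + 176 * u ^ 4 + 29 * u ^ 3 + 24 * u + 4 ≤ n) (lt_add_one u)
      (by omega)
  obtain ⟨hu13600, hE1, hE2⟩ := hu₀ u hu₀u
  have hu1 : 1 ≤ u := le_trans (by norm_num) hu13600
  -- `n < T(u+1) ≤ 13600 u⁵`
  have hn_lt : n < 13600 * u ^ 5 := by
    have h2 : u + 1 ≤ 2 * u := by omega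
    have h5 : (u + 1) ^ 5 ≤ 32 * u ^ 5 := by
      calc (u + 1) ^ 5 ≤ (2 * u) ^ 5 := Nat.pow_le_pow_left h2 5
        _ = 32 * u ^ 5 := by ring
    have h1' : 1 ≤ u + 1 := by omega
    have h45 : (u + 1) ^ 4 ≤ (u + 1) ^ 5 := Nat.pow_le_pow_right h1' (by norm_num)
    have h35 : (u + 1) ^ 3 ≤ (u + 1) ^ 5 := Nat.pow_le_pow_right h1' (by norm_num)
    have h15 : (u + 1) ≤ (u + 1) ^ 5 := by
      calc (u + 1) = (u + 1) ^ 1 := (pow_one _).symm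
        _ ≤ (u + 1) ^ 5 := Nat.pow_le_pow_right h1' (by norm_num)
    omega
  -- the parameters
  set m : ℕ := u ^ 3 with hm
  set L : ℕ := 8 * m * u + 3 * m with hL
  set K : ℕ := 2 * L + 4 * m + 2 with hK
  set N : ℕ := 2 * n - 2 * L with hN
  have hT : 12 * K * u + 3 * L + 2 * K ≤ n := by
    have : 12 * K * u + 3 * L + 2 * K = 192 * u ^ 5 + 176 * u ^ 4 + 29 * u ^ 3 + 24 * u + 4 := by
      simp only [hK, hL, hm]; ring
    rw [this]; exact hTu
  have hNle : N ≤ 2 * n := by rw [hN]; omega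
  have hNpos : 0 < N := by
    have eT : 12 * K * u = 12 * (K * u) := by ring
    rw [eT] at hT
    rw [hN]; omega
  have hn3 : 3 ≤ n := by omega
  -- real-valued size bounds
  have hur : (1 : ℝ) ≤ u := by exact_mod_cast hu1
  have hnr : (n : ℝ) ≤ 13600 * (u : ℝ) ^ 5 := by exact_mod_cast hn_lt.le
  have hNr : (0 : ℝ) < N := by exact_mod_cast hNpos
  have hN2 : (N : ℝ) ≤ 2 * n := by exact_mod_cast hNle
  have hNr5 : (N : ℝ) ≤ 27200 * (u : ℝ) ^ 5 := by linarith
  -- the band estimate `2N e^{-m²/(2N)} 2^N ≤ 2^N/(2N)`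
  have hband : 2 * (N : ℝ) * Real.exp (-((m : ℝ) ^ 2 / (2 * N))) * 2 ^ N ≤ 2 ^ N / (2 * N) := by
    -- `m²/(2N) ≥ u/54400`
    have h1 : (u : ℝ) / 54400 ≤ (m : ℝ) ^ 2 / (2 * N) := by
      rw [div_le_div_iff₀ (by norm_num) (mul_pos (by norm_num) hNr)]
      have hm6 : (m : ℝ) ^ 2 = (u : ℝ) ^ 6 := by
        rw [hm]; push_cast; ring
      rw [hm6]
      have : (u : ℝ) * (2 * N) ≤ (u : ℝ) * (54400 * (u : ℝ) ^ 5) := by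
        have hu0 : (0 : ℝ) ≤ u := by positivity
        nlinarith
      nlinarith
    have h2 : Real.exp (-((m : ℝ) ^ 2 / (2 * N))) ≤ Real.exp (-(1 / 54400 : ℝ)) ^ u := by
      rw [← Real.exp_nat_mul, Real.exp_le_exp]
      have : (u : ℝ) * -(1 / 54400 : ℝ) = -((u : ℝ) / 54400) := by ring
      rw [this]
      linarith
    have h3 : 4 * (N : ℝ) ^ 2 * Real.exp (-((m : ℝ) ^ 2 / (2 * N))) ≤ 1 := by
      calc 4 * (N : ℝ) ^ 2 * Real.exp (-((m : ℝ) ^ 2 / (2 * N)))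
          ≤ 4 * (27200 * (u : ℝ) ^ 5) ^ 2 * Real.exp (-(1 / 54400 : ℝ)) ^ u := by
            gcongr
        _ = 4 * 27200 ^ 2 * (u : ℝ) ^ 10 * Real.exp (-(1 / 54400 : ℝ)) ^ u := by ring
        _ ≤ 1 := hE1.le
    have hN0 : (N : ℝ) ≠ 0 := hNr.ne'
    rw [show 2 * (N : ℝ) * Real.exp (-((m : ℝ) ^ 2 / (2 * N))) * 2 ^ N
        = (4 * (N : ℝ) ^ 2 * Real.exp (-((m : ℝ) ^ 2 / (2 * N)))) * (2 ^ N / (2 * N)) by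
      field_simp; ring]
    calc (4 * (N : ℝ) ^ 2 * Real.exp (-((m : ℝ) ^ 2 / (2 * N)))) * (2 ^ N / (2 * N))
        ≤ 1 * (2 ^ N / (2 * N)) := by gcongr
      _ = 2 ^ N / (2 * N) := one_mul _
  -- the measure and the union bound
  obtain ⟨μ, hμ1, hμS⟩ := exists_thick_measure_of_le hu1 hm hL hK hN hT hband
  have hmain := one_le_complexity_mul_of_spread hn3 μ hμ1 hμS
  push_cast at hmain
  -- `2^u ≤ L₊(NN_n)`
  set s : ℕ := complexity (nestFreeMatchingPoly n ℝ≥0) with hs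
  have h2u : (2 : ℝ) ^ u ≤ (s : ℝ) := by
    by_contra hlt
    rw [not_le] at hlt
    have hpos : (0 : ℝ) < ((n : ℝ) + 1) ^ 2 * (2 * (N : ℝ) * (3 / 4 : ℝ) ^ (4 * u)) := by positivity
    have hlt' : 4 * (s : ℝ) * ((n : ℝ) + 1) ^ 2 * (2 * (N : ℝ) * (3 / 4 : ℝ) ^ (4 * u))
        < 4 * (2 : ℝ) ^ u * ((n : ℝ) + 1) ^ 2 * (2 * (N : ℝ) * (3 / 4 : ℝ) ^ (4 * u)) := by
      have := mul_lt_mul_of_pos_right hlt hpos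
      nlinarith
    -- `4 · 2^u (n+1)² · 2N (3/4)^{4u} ≤ 4 · 13601² · 54400 · u¹⁵ (81/128)^u < 1`
    have hpow : (2 : ℝ) ^ u * (3 / 4 : ℝ) ^ (4 * u) = (81 / 128 : ℝ) ^ u := by
      rw [pow_mul, ← mul_pow]; norm_num
    have hn1 : (n : ℝ) + 1 ≤ 13601 * (u : ℝ) ^ 5 := by
      have : (1 : ℝ) ≤ (u : ℝ) ^ 5 := one_le_pow₀ hur
      linarith
    have hB : ((n : ℝ) + 1) ^ 2 ≤ (13601 * (u : ℝ) ^ 5) ^ 2 := by gcongr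
    have hfin : 4 * (2 : ℝ) ^ u * ((n : ℝ) + 1) ^ 2 * (2 * (N : ℝ) * (3 / 4 : ℝ) ^ (4 * u)) < 1 := by
      calc 4 * (2 : ℝ) ^ u * ((n : ℝ) + 1) ^ 2 * (2 * (N : ℝ) * (3 / 4 : ℝ) ^ (4 * u))
          = 4 * ((n : ℝ) + 1) ^ 2 * (2 * (N : ℝ)) * ((2 : ℝ) ^ u * (3 / 4 : ℝ) ^ (4 * u)) := by
            ring
        _ = 4 * ((n : ℝ) + 1) ^ 2 * (2 * (N : ℝ)) * (81 / 128 : ℝ) ^ u := by rw [hpow]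
        _ ≤ 4 * (13601 * (u : ℝ) ^ 5) ^ 2 * (2 * (27200 * (u : ℝ) ^ 5)) * (81 / 128 : ℝ) ^ u := by
            gcongr
        _ = 4 * 13601 ^ 2 * 54400 * (u : ℝ) ^ 15 * (81 / 128 : ℝ) ^ u := by ring
        _ < 1 := hE2
    linarith
  -- `n^{1/6} ≤ u`
  have hroot : (n : ℝ) ^ ((1 : ℝ) / 6) ≤ u := by
    have hn6 : (n : ℝ) ≤ (u : ℝ) ^ 6 := by
      have h13600 : (13600 : ℝ) ≤ u := by exact_mod_cast hu13600
      have hu5 : (0 : ℝ) ≤ (u : ℝ) ^ 5 := by positivity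
      calc (n : ℝ) ≤ 13600 * (u : ℝ) ^ 5 := hnr
        _ ≤ (u : ℝ) * (u : ℝ) ^ 5 := mul_le_mul_of_nonneg_right h13600 hu5
        _ = (u : ℝ) ^ 6 := by ring
    have h := Real.rpow_le_rpow (Nat.cast_nonneg n) hn6 (by norm_num : (0 : ℝ) ≤ 1 / 6)
    have h6 : ((u : ℝ) ^ 6) ^ ((1 : ℝ) / 6) = u := by
      rw [show ((1 : ℝ) / 6) = ((6 : ℕ) : ℝ)⁻¹ by norm_num]
      exact Real.pow_rpow_inv_natCast (Nat.cast_nonneg u) (by norm_num)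
    rw [h6] at h
    exact h
  calc (2 : ℝ) ^ ((n : ℝ) ^ ((1 : ℝ) / 6)) ≤ (2 : ℝ) ^ ((u : ℕ) : ℝ) :=
        Real.rpow_le_rpow_of_exponent_le (by norm_num) hroot
    _ = (2 : ℝ) ^ u := Real.rpow_natCast 2 u
    _ ≤ s := h2u

/-- **`NNMonotoneExpBound` (support item stmt-ValiantsHypothesis-22994 of route `FifoMatching`).**
There are `ε > 0` (here `ε = 1/6`) and `n₀` such that `2^{n^ε} ≤ L₊(NN_n)` for all `n ≥ n₀`:
the nest-free matching polynomials have stretched-exponential monotone circuit complexity,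
uniformly in `n`.  Proof: `exp_lower_bound` (thick-queue measure at every length + the union
bound of the crux `NNMonotoneHard`), after unfolding the route's inlined `NN_n` to
`nestFreeMatchingPoly n ℝ≥0` (definitionally equal). [folklore] -/
theorem nnMonotoneExpBound_proof :
    Summit.ValiantsHypothesis.ValiantsHypothesis.Theses.FifoMatching.NNMonotoneExpBound := by
  unfold Summit.ValiantsHypothesis.ValiantsHypothesis.Theses.FifoMatching.NNMonotoneExpBound
  change ∃ ε : ℝ, 0 < ε ∧ ∃ n₀ : ℕ, ∀ n : ℕ, n₀ ≤ n →
    (2 : ℝ) ^ ((n : ℝ) ^ ε) ≤ (complexity (nestFreeMatchingPoly n ℝ≥0) : ℝ)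
  exact ⟨1 / 6, by norm_num, exp_lower_bound⟩

end Summit.ValiantsHypothesis.ValiantsHypothesis.Theorems.FifoMatching.NNMonotoneExpBound
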